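import Summits.BirchSwinnertonDyer.BirchSwinnertonDyer.Theorems.Rank2ShaTierKitW16
import Summits.BirchSwinnertonDyer.BirchSwinnertonDyer.Theorems.Rank2ShaTierKitM4
import HarnessLib

/-!
# BirchSwinnertonDyer — rank-2 `Ш[3^∞]` cell: frame «w16-bound» at `p = 3` (torsion-free, `E[3]`
# reducible by a rational root of `Ψ₃`) with the COMPLETE minimality criterion (Kraus at `2` and `3`)

HONEST FRAMING (cell `b2b-bsdr2sha`, run/shared/lean/b2b/bsd-rank2-sha/): per-pair certified
theorems «cited hypotheses ∧ certified computation ⇒ `Ш(E/ℚ)[p^∞]` finite of order dividing `p^k`»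
for rank-2 curves at good ordinary primes; NO claim on BSD in rank `≥ 2`, no class-level theorem,
every published input is a NAMED HYPOTHESIS of the tree (nothing is asserted or minted here).

`Rank2ShaTierKitW16.lean` books a `p = 3` row with reducible `E[3]` and `3 ∤ #E(ℚ)_tors` under Wuthrich
2014 Thm. 16 from `ShaRow.checkW₃ = checkR₃ ∧ torsFreeCheck`, whose base test `check₃` certifies global
minimality by `minCheck ∨ minCheck₂ ∨ minCheck₃`. Those Boolean criteria quantify over EVERY `q < B`
(composite `q` included), so the three census curves `13760t1`, `15040bk1`, `20672bg1` (`ord₂ Δ ≥ 24`,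
`2 ∣ c₄`; minimal at `2` by Kraus) escape all three at `q = 4`. `Rank2ShaTierKitM4.lean` supplies the
complete criterion `ShaRow.minCheck₄` with its soundness `isGloballyMinimal_of_minCheck₄`; this file is the
`p = 3` «w16-bound, torsion-free» twin of that repair (two `Bool` tests, theorems; no new mathematical
object, no axiom):

* `ShaRow.check₃₄` — `Rank2ShaTierKit3`'s `check₃` with the minimality slot replaced by `minCheck₄`;
  `ShaRow.checkW₃₄ := check₃₄ ∧ red3Check R.e R.sw.l₂ R.sw.sq₂ R.sw.w₁ ∧ torsFreeCheck R.e 3 R.sw.l₁ R.sw.sq₁ R.sw.n₁`;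
* the base consequences, BUNDLED with the hypothesis `R.check₃₄ = true` explicit (the shape of
  `Rank2ShaTierKitM4`'s `prime_isElliptic_isGloballyMinimal_of_check₄` /
  `isOrdinaryAt_reductionPointCount_tamagawaProduct_of_check₄`): `check₃₄_spec`,
  `p_eq_three_isElliptic_isGloballyMinimal_of_check₃₄`,
  `isOrdinaryAt_reductionPointCount_tamagawaProduct_of_check₃₄` (proofs of `Rank2ShaTierKit3`,
  minimality from `isGloballyMinimal_of_minCheck₄`);
* `ShaRow.w16₃₄`, `ShaRow.w16₃₄_eq_one` — `Rank2ShaTierKitW16`'s `w16₃` / `w16₃_eq_one` verbatim on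
  `checkW₃₄`; READERS `booked_w16One₃₄` (certificate `R.checkW₃₄ = true ∧ R.k ≤ 0 ∧ 2 ≤ rank`) and
  `booked_w16Le₃₄`.

References: C. Wuthrich, Doc. Math. 19 (2014), Thm. 16 [Wuthrich2014]; A. Kraus, Manuscripta Math. 65
(1989), Prop. 1 and Prop. 2 [Kraus1989]; A. Agashe, K. Ribet, W. Stein, PAMQ 2 (2006), Thm. 2.6
[AgasheRibetStein2006]; J. H. Silverman, AEC (2009), VII.1 Remark 1.1, VII.3.1(b) [SilvermanAEC2009];
W. Stein, C. Wuthrich, Math. Comp. 82 (2013), Alg. 11.1 [SteinWuthrich2013].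
-/

set_option autoImplicit false

-- single-conjunct summit: `Summit.BirchSwinnertonDyer.BirchSwinnertonDyer.…` repeats the name by design
set_option linter.dupNamespace false

noncomputable section

open scoped Classical MatrixGroups ModularForm

open CongruenceSubgroup WeierstrassCurve Literature.NumberTheory.EllipticCurves
  Literature.NumberTheory.EllipticCurves.ModularForms
  Literature.NumberTheory.EllipticCurves.Rank1Residual
  Summit.BirchSwinnertonDyer.BirchSwinnertonDyer.Rank2Observatory

namespace Summit.BirchSwinnertonDyer.BirchSwinnertonDyer.Rank2Sha

namespace ShaRow

variable (R : ShaRow)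

/-- **The BASE kernel test of a compact row at `p = 3`, complete minimality form**: `R.p = 3`, `3 ∤ Δ`,
`#Ẽ(𝔽₃) = 4 − a₃`, `3 ∤ a₃` (good ORDINARY at `3`), the complete finite minimality criterion `minCheck₄`
(Kraus at `2` and `3`), and an EXACT Tamagawa row certificate. [cite: Kraus1989, Prop. 1 and Prop. 2]
[cite: SilvermanAEC2009, VII.1 Remark 1.1] -/
def check₃₄ : Bool :=
  decide (R.p = 3) && decide (¬ ((3 : ℤ) ∣ R.e.Δ)) &&
    decide ((curveCount 3 R.e : ℤ) = 3 + 1 - R.ap) && decide (¬ ((3 : ℤ) ∣ R.ap)) &&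
    R.minCheck₄ &&
    Tam.TamZ.rowCheckZ R.tam R.tamX R.tamZ R.e && Tam.TamZ.rowExactZ R.tam R.tamX R.tamZ

/-- **The kernel test of a `p = 3` row of frame «w16-bound», torsion-free case, complete minimality
form**: `check₃₄` AND the reducibility certificate `red3Check` in the slots `(w₁, l₂, sq₂)` of `R.sw`
AND the torsion certificate `torsFreeCheck` in the slots `(l₁, sq₁, n₁)` (`3 ∤ #E(ℚ)_tors`).
[cite: Wuthrich2014, Thm. 16 (p. 397)] [cite: SilvermanAEC2009, VII.3.1(b)] -/
def checkW₃₄ : Bool :=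
  R.check₃₄ && red3Check R.e R.sw.l₂ R.sw.sq₂ R.sw.w₁ && torsFreeCheck R.e 3 R.sw.l₁ R.sw.sq₁ R.sw.n₁

variable {R}

/-- A row passing `checkW₃₄` passes `check₃₄`. [folklore] -/
theorem check₃₄_of_checkW₃₄ (h : R.checkW₃₄ = true) : R.check₃₄ = true := by
  simp only [checkW₃₄, Bool.and_eq_true] at h; exact h.1.1

/-- A row passing `checkW₃₄` has REDUCIBLE `E[3]` (once the curve is known elliptic). [cite: SilvermanAEC2009, III Ex. 3.7] -/
theorem not_irr_of_checkW₃₄ (h : R.checkW₃₄ = true) [(R.e.baseChange ℚ).IsElliptic] :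
    ¬ (R.e.baseChange ℚ).HasIrreducibleModPGaloisRep 3 := by
  simp only [checkW₃₄, Bool.and_eq_true] at h
  exact not_irr_three_of_red3Check h.1.2

/-- A row passing `checkW₃₄` passes the torsion certificate. [folklore] -/
theorem torsFreeCheck_of_checkW₃₄ (h : R.checkW₃₄ = true) :
    torsFreeCheck R.e 3 R.sw.l₁ R.sw.sq₁ R.sw.n₁ = true := by
  simp only [checkW₃₄, Bool.and_eq_true] at h; exact h.2

/-- From a tier theorem `rows.all checkW₃₄ = true` to the test of a member. [folklore] -/
theorem checkW₃₄_of_all {rows : List ShaRow} (hall : rows.all ShaRow.checkW₃₄ = true) {R : ShaRow}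
    (hmem : R ∈ rows) : R.checkW₃₄ = true :=
  List.all_eq_true.mp hall R hmem

/-- Unpacking a passing `p = 3` base check, complete minimality form. [folklore] -/
theorem check₃₄_spec (h : R.check₃₄ = true) :
    R.p = 3 ∧ ¬ ((3 : ℤ) ∣ R.e.Δ) ∧ (curveCount 3 R.e : ℤ) = 3 + 1 - R.ap ∧ ¬ ((3 : ℤ) ∣ R.ap) ∧
      R.minCheck₄ = true ∧
      Tam.TamZ.rowCheckZ R.tam R.tamX R.tamZ R.e = true ∧
      Tam.TamZ.rowExactZ R.tam R.tamX R.tamZ = true := by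
  simp only [check₃₄, Bool.and_eq_true, decide_eq_true_eq] at h
  obtain ⟨⟨⟨⟨⟨⟨h3, hΔ⟩, hc⟩, hap⟩, hmin⟩, ht⟩, hx⟩ := h
  exact ⟨h3, hΔ, hc, hap, hmin, ht, hx⟩

/-- A row passing `check₃₄` has `p = 3`, an ELLIPTIC curve (`Δ ≠ 0`, from `3 ∤ Δ`) AND a globally MINIMAL
integer model (complete criterion, Kraus at `2` and `3`) — bundled, hypothesis explicit.
[cite: Kraus1989, Prop. 1 and Prop. 2] [cite: SilvermanAEC2009, VII.1 Remark 1.1] -/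
theorem p_eq_three_isElliptic_isGloballyMinimal_of_check₃₄ (h : R.check₃₄ = true) :
    R.p = 3 ∧ (R.e.baseChange ℚ).IsElliptic ∧ (R.e.baseChange ℚ).IsGloballyMinimal := by
  obtain ⟨h3, hΔ, -, -, hmin, -⟩ := check₃₄_spec h
  exact ⟨h3, Literature.NumberTheory.EllipticCurves.isElliptic_baseChange_int _ fun h0 =>
    hΔ (by rw [h0]; exact dvd_zero _), isGloballyMinimal_of_minCheck₄ hmin⟩

/-- A row passing `check₃₄` is good ORDINARY at `3` (H1), the tree's `#Ẽ(𝔽₃)` is the kernel count, and the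
Tamagawa product IS the certificate's `rowValueZ` (H9) — bundled, hypothesis explicit.
[cite: SilvermanAEC2009, VII.1 Remark 1.1] [cite: SilvermanATAEC1994, IV.9.4] -/
theorem isOrdinaryAt_reductionPointCount_tamagawaProduct_of_check₃₄ (h : R.check₃₄ = true)
    [(R.e.baseChange ℚ).IsGloballyMinimal] :
    IsOrdinaryAt (R.e.baseChange ℚ) 3 ∧
      (R.e.baseChange ℚ).reductionPointCount 3 = curveCount 3 R.e ∧
      (R.e.baseChange ℚ).tamagawaProduct = Tam.TamZ.rowValueZ R.tam R.tamX R.tamZ := by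
  obtain ⟨-, hΔ, hc, hap, -, ht, hx⟩ := check₃₄_spec h
  refine ⟨isOrdinaryAt_baseChange_int_of_card 3 R.e hΔ (card_eq_curveCount 3 (by decide) R.e hΔ) ?_,
    by rw [reductionPointCount_baseChange_int, card_eq_curveCount 3 (by decide) R.e hΔ],
    Tam.TamZ.tamagawaProduct_eqZ ht inferInstance hx⟩
  rw [hc]
  have : (3 : ℤ) + 1 - (3 + 1 - R.ap) = R.ap := by ring
  rw [show ((3 : ℕ) : ℤ) = 3 from rfl, this]
  exact hap

/-- **TIER ROW THEOREM at `p = 3`, frame «w16-bound», torsion-free, complete minimality form.** As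
`ShaRow.w16₃` for a row passing `checkW₃₄`: GIVEN `hW16` (Wuthrich 2014 Thm. 16), `hS` (PRS), `h26`
(Agashe–Ribet–Stein Thm. 2.6), an EXPLICIT lattice-optimal parametrisation datum at a level `N ≤ 130000`,
the rank certificate, the L-datum and THE canonical `3`-adic height datum: `rank_ℤ E(ℚ) = 2`,
`Ш(E/ℚ)[3^∞]` finite, `Reg_3 ≠ 0`, `ord_3 #Ш(E/ℚ)[3^∞] ≤ R.k` (torsion term certified `0`). Per pair; NOT a
class theorem. [cite: Wuthrich2014, Thm. 16 (p. 397)] [cite: AgasheRibetStein2006, Thm. 2.6]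
[cite: BalakrishnanMullerStein2015, Thm. 1.7] [cite: SteinWuthrich2013, §§3–4 and Alg. 11.1] -/
theorem w16₃₄ (h : R.checkW₃₄ = true) [(R.e.baseChange ℚ).IsElliptic] [(R.e.baseChange ℚ).IsGloballyMinimal]
    (hW16 : Wuthrich2014.charIdeal_dvd_padicLFunction) (hS : Schneider1985_order_charGenerator_odd)
    (h26 : AgasheRibetStein2006.cremona_abs_maninConstant_eq_one_of_level_le)
    {N : ℕ} [NeZero N] (D : ModularParametrizationData (R.e.baseChange ℚ) N)
    (hopt : ∀ z ∈ D.L.lattice, ∃ w ∈ periodLattice D.f, z = D.c * w) (hN : N ≤ 130000)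
    (hlow : 2 ≤ (R.e.baseChange ℚ).mordellWeilRank)
    (hLp : PowerSeries.coeff 2 (padicLFunction D.f (unitRoot (R.e.baseChange ℚ) 3 : ℚ_[3])) ≠ 0)
    (hcoeff : (PowerSeries.coeff 2
      (padicLFunction D.f (unitRoot (R.e.baseChange ℚ) 3 : ℚ_[3]))).valuation = R.a)
    (Dh : PAdicHeightData (R.e.baseChange ℚ) 3) (hDh : Dh.IsCanonical)
    (hreg : (padicRegulator Dh).valuation = R.b) :
    (R.e.baseChange ℚ).mordellWeilRank = 2 ∧
      Finite (AddCommGroup.primaryComponent (R.e.baseChange ℚ).sha 3) ∧ SchneiderConjecture Dh ∧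
      (padicValNat 3 (Nat.card (AddCommGroup.primaryComponent (R.e.baseChange ℚ).sha 3)) : ℤ) ≤ R.k := by
  have hb := check₃₄_of_checkW₃₄ h
  obtain ⟨hordin, hcnt, htam⟩ := isOrdinaryAt_reductionPointCount_tamagawaProduct_of_check₃₄ hb
  have hred := not_irr_of_checkW₃₄ h
  obtain ⟨hr, hfin, hSch, hle⟩ := padicBSD_inequality_of_wuthrich16_odd_of_coeff_ne_zero_of_optimal
    hW16 hS h26 (R.e.baseChange ℚ) 3 (by decide) hordin.1 hordin.2 hred D hopt hN Dh hDh hlow hLp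
  haveI := hfin
  refine ⟨hr, hfin, hSch, ?_⟩
  have hk := padicValNat_card_shaPrimary_le_of_valuation_le (R.e.baseChange ℚ) 3 (by decide) hordin D.f
    Dh hSch hLp hle hcoeff hreg
  rw [padicValNat_torsionOrder_eq_zero_of_torsFreeCheck (torsFreeCheck_of_checkW₃₄ h), hcnt, htam] at hk
  rw [ShaRow.k, (p_eq_three_isElliptic_isGloballyMinimal_of_check₃₄ hb).1]
  push_cast at hk ⊢
  linarith

/-- **`p = 3`, frame «w16-bound», torsion-free, complete minimality form, `R.k ≤ 0`: `Ш(E/ℚ)[3^∞] = 0`.**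
[cite: Wuthrich2014, Thm. 16 (p. 397)] [cite: SteinWuthrich2013, Thm. 1.1 and Alg. 11.1] -/
theorem w16₃₄_eq_one (h : R.checkW₃₄ = true) [(R.e.baseChange ℚ).IsElliptic]
    [(R.e.baseChange ℚ).IsGloballyMinimal]
    (hW16 : Wuthrich2014.charIdeal_dvd_padicLFunction) (hS : Schneider1985_order_charGenerator_odd)
    (h26 : AgasheRibetStein2006.cremona_abs_maninConstant_eq_one_of_level_le)
    {N : ℕ} [NeZero N] (D : ModularParametrizationData (R.e.baseChange ℚ) N)
    (hopt : ∀ z ∈ D.L.lattice, ∃ w ∈ periodLattice D.f, z = D.c * w) (hN : N ≤ 130000)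
    (hlow : 2 ≤ (R.e.baseChange ℚ).mordellWeilRank)
    (hLp : PowerSeries.coeff 2 (padicLFunction D.f (unitRoot (R.e.baseChange ℚ) 3 : ℚ_[3])) ≠ 0)
    (hcoeff : (PowerSeries.coeff 2
      (padicLFunction D.f (unitRoot (R.e.baseChange ℚ) 3 : ℚ_[3]))).valuation = R.a)
    (Dh : PAdicHeightData (R.e.baseChange ℚ) 3) (hDh : Dh.IsCanonical)
    (hreg : (padicRegulator Dh).valuation = R.b) (hk0 : R.k ≤ 0) :
    (R.e.baseChange ℚ).mordellWeilRank = 2 ∧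
      Finite (AddCommGroup.primaryComponent (R.e.baseChange ℚ).sha 3) ∧ SchneiderConjecture Dh ∧
      Nat.card (AddCommGroup.primaryComponent (R.e.baseChange ℚ).sha 3) = 1 := by
  obtain ⟨hr, hfin, hSch, hle⟩ := w16₃₄ h hW16 hS h26 D hopt hN hlow hLp hcoeff Dh hDh hreg
  haveI := hfin
  have hv0 : padicValNat 3 (Nat.card (AddCommGroup.primaryComponent (R.e.baseChange ℚ).sha 3)) = 0 := by
    have := hle.trans hk0
    omega
  have hndvd : ¬ 3 ∣ Nat.card (AddCommGroup.primaryComponent (R.e.baseChange ℚ).sha 3) := by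
    rcases padicValNat.eq_zero_iff.mp hv0 with h1 | h0 | hnd
    · exact absurd h1 (by decide)
    · exact absurd h0 Nat.card_pos.ne'
    · exact hnd
  exact ⟨hr, hfin, hSch, natCard_primaryComponent_eq_one 3 hndvd⟩

/-- **READER at `p = 3`, frame «w16-bound», torsion-free, complete minimality form, V-BOUND 0**
(«`Ш(E/ℚ)[3^∞] = 0`»): certificate `checkW₃₄ ∧ k ≤ 0 ∧ 2 ≤ rank`. [cite: Wuthrich2014, Thm. 16 (p. 397)]
[cite: Kraus1989, Prop. 1 and Prop. 2] [cite: AgasheRibetStein2006, Thm. 2.6]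
[cite: SteinWuthrich2013, Alg. 11.1 and Prop. 11.2] -/
theorem booked_w16One₃₄ (h : R.checkW₃₄ = true ∧ R.k ≤ 0 ∧ 2 ≤ (R.e.baseChange ℚ).mordellWeilRank) :
    haveI := (p_eq_three_isElliptic_isGloballyMinimal_of_check₃₄ (check₃₄_of_checkW₃₄ h.1)).2.1
    haveI := (p_eq_three_isElliptic_isGloballyMinimal_of_check₃₄ (check₃₄_of_checkW₃₄ h.1)).2.2
    ∀ (_hW16 : Wuthrich2014.charIdeal_dvd_padicLFunction) (_hS : Schneider1985_order_charGenerator_odd)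
      (_h26 : AgasheRibetStein2006.cremona_abs_maninConstant_eq_one_of_level_le)
      {N : ℕ} [NeZero N] (D : ModularParametrizationData (R.e.baseChange ℚ) N)
      (_hopt : ∀ z ∈ D.L.lattice, ∃ w ∈ periodLattice D.f, z = D.c * w) (_hN : N ≤ 130000)
      (_hLp : PowerSeries.coeff 2 (padicLFunction D.f (unitRoot (R.e.baseChange ℚ) 3 : ℚ_[3])) ≠ 0)
      (_hcoeff : (PowerSeries.coeff 2
        (padicLFunction D.f (unitRoot (R.e.baseChange ℚ) 3 : ℚ_[3]))).valuation = R.a)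
      (Dh : PAdicHeightData (R.e.baseChange ℚ) 3) (_hDh : Dh.IsCanonical)
      (_hreg : (padicRegulator Dh).valuation = R.b),
      (R.e.baseChange ℚ).mordellWeilRank = 2 ∧
        Finite (AddCommGroup.primaryComponent (R.e.baseChange ℚ).sha 3) ∧ SchneiderConjecture Dh ∧
        Nat.card (AddCommGroup.primaryComponent (R.e.baseChange ℚ).sha 3) = 1 := by
  intro hW16 hS h26 N _ D hopt hN hLp hcoeff Dh hDh hreg
  haveI := (p_eq_three_isElliptic_isGloballyMinimal_of_check₃₄ (check₃₄_of_checkW₃₄ h.1)).2.1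
  haveI := (p_eq_three_isElliptic_isGloballyMinimal_of_check₃₄ (check₃₄_of_checkW₃₄ h.1)).2.2
  exact w16₃₄_eq_one h.1 hW16 hS h26 D hopt hN h.2.2 hLp hcoeff Dh hDh hreg h.2.1

/-- **READER at `p = 3`, frame «w16-bound», torsion-free, complete minimality form, V-BOUND `b`**: from
`checkW₃₄ ∧ 2 ≤ rank`: `rank = 2`, `Ш(E/ℚ)[3^∞]` finite, `Reg_3 ≠ 0`, `ord_3 #Ш(E/ℚ)[3^∞] ≤ R.k`.
[cite: Wuthrich2014, Thm. 16 (p. 397)] [cite: Kraus1989, Prop. 1 and Prop. 2]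
[cite: AgasheRibetStein2006, Thm. 2.6] [cite: SteinWuthrich2013, Alg. 11.1 and Prop. 11.2] -/
theorem booked_w16Le₃₄ (h : R.checkW₃₄ = true ∧ 2 ≤ (R.e.baseChange ℚ).mordellWeilRank) :
    haveI := (p_eq_three_isElliptic_isGloballyMinimal_of_check₃₄ (check₃₄_of_checkW₃₄ h.1)).2.1
    haveI := (p_eq_three_isElliptic_isGloballyMinimal_of_check₃₄ (check₃₄_of_checkW₃₄ h.1)).2.2
    ∀ (_hW16 : Wuthrich2014.charIdeal_dvd_padicLFunction) (_hS : Schneider1985_order_charGenerator_odd)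
      (_h26 : AgasheRibetStein2006.cremona_abs_maninConstant_eq_one_of_level_le)
      {N : ℕ} [NeZero N] (D : ModularParametrizationData (R.e.baseChange ℚ) N)
      (_hopt : ∀ z ∈ D.L.lattice, ∃ w ∈ periodLattice D.f, z = D.c * w) (_hN : N ≤ 130000)
      (_hLp : PowerSeries.coeff 2 (padicLFunction D.f (unitRoot (R.e.baseChange ℚ) 3 : ℚ_[3])) ≠ 0)
      (_hcoeff : (PowerSeries.coeff 2
        (padicLFunction D.f (unitRoot (R.e.baseChange ℚ) 3 : ℚ_[3]))).valuation = R.a)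
      (Dh : PAdicHeightData (R.e.baseChange ℚ) 3) (_hDh : Dh.IsCanonical)
      (_hreg : (padicRegulator Dh).valuation = R.b),
      (R.e.baseChange ℚ).mordellWeilRank = 2 ∧
        Finite (AddCommGroup.primaryComponent (R.e.baseChange ℚ).sha 3) ∧ SchneiderConjecture Dh ∧
        (padicValNat 3 (Nat.card (AddCommGroup.primaryComponent (R.e.baseChange ℚ).sha 3)) : ℤ) ≤
          R.k := by
  intro hW16 hS h26 N _ D hopt hN hLp hcoeff Dh hDh hreg
  haveI := (p_eq_three_isElliptic_isGloballyMinimal_of_check₃₄ (check₃₄_of_checkW₃₄ h.1)).2.1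
  haveI := (p_eq_three_isElliptic_isGloballyMinimal_of_check₃₄ (check₃₄_of_checkW₃₄ h.1)).2.2
  exact w16₃₄ h.1 hW16 hS h26 D hopt hN h.2 hLp hcoeff Dh hDh hreg

end ShaRow

end Summit.BirchSwinnertonDyer.BirchSwinnertonDyer.Rank2Sha

end
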